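import Literature.NumberTheory.Automorphic.BianchiPrototypes
import Literature.NumberTheory.Automorphic.BianchiCuspFundamentalSet
import Literature.NumberTheory.Automorphic.BianchiCuspStabilizerFinite
import Literature.NumberTheory.Automorphic.ArithmeticQuotientCohomologyFiniteProofs
import Literature.Algebra.Homology.GroupCohomologyGoodCoverFinite
import HarnessLib

/-!
# Finiteness of the cohomology of `GL₂(𝓞_K)` with finite coefficients, `K` imaginary quadratic

Topic `NumberTheory/Automorphic`; namespace `Literature.NumberTheory.Automorphic`, grouping
sub-namespace `BianchiCusp`.  Theorems only: no definition, no named fact, no `sorry`.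

**Theorem** (`finite_groupCohomology_gl2`).  Let `K` be an imaginary quadratic field and `M` a
finite `ℤ[GL₂(𝓞_K)]`-module.  Then `Hⁿ(GL₂(𝓞_K), M)` is finite for every `n`.
**Corollary** (`finite_groupCohomology_congruenceSubgroup_gl2`).  The same for every congruence
subgroup `Γ_U = GL₂(K) ∩ U`, `U ≤ GL₂(𝔸_K^∞)` compact open (commensurability with `GL₂(𝓞_K)`,
`BigHeckeGLn.commensurable_comap_globalEmbedding_glIntegers`, and
`finite_groupCohomology_of_commensurable`) — the instance `n = 2`, `K` imaginary quadratic of the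
named fact `BorelSerre1973_finite_groupCohomology_congruenceSubgroup` of
`ArithmeticQuotientCohomologyFinite`, here PROVED.

This is the case `GL₂` over imaginary quadratic fields of the finiteness theorem of Borel–Serre
for arithmetic groups ([BorelSerre1973, §11]; for Bianchi groups see
[ElstrodtGrunewaldMennicke1998, Ch. 2 §2.2–2.3, Ch. 7 §7.2–7.5]).  PROOF (torsion allowed
throughout).  `Γ = GL₂(𝓞_K)` acts through `σ : K → ℂ` on the contractible cone `𝒫` of positive
definite binary Hermitian forms (`BianchiConeModel`).  THE COVER (first part of this file, all
statements phrased with the explicit action map `act (toGL σ γ)`):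

* `exists_thick_finset` — finitely many thick boxes (with compact hulls in the cone) receive, up
  to scalars and `Γ`, every form at which all cusps have depth `≥ 1` (compact fundamental set of
  the thick part, `BianchiCuspFundamentalSet`; Dirichlet, `BianchiDirichlet`);
* `exists_act_mem_cuspBox` — a form with a cusp of depth `< 1` is moved into the cusp box of one
  of the finitely many cusp representatives (`exists_inequivalent_representatives`);
* `finite_thick_thick`, `finite_thick_cusp`, `finite_cusp_thick`, `finite_cusp_cusp`,
  `cuspRel_of_mem_cuspBox` — for any two prototypes `P, P'` only finitely many `γ` have
  `γP ∩ P' ≠ ∅` (properness up to scalars `finite_gamma_meeting`, `finite_gamma_cusp`,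
  `finite_parabolic_of_hcoord_le`).

THE CONCLUSION.  The `Γ`-translates of the finitely many convex open prototypes — thick boxes and
one cusp box per cusp class (`BianchiPrototypes`) — cover `𝒫`; finite intersections of
translates are convex, hence contractible; the abstract nerve criterion
`finite_groupCohomology_of_translateCover` (`GroupCohomologyGoodCoverFinite`: the Čech complex of
functions on the nerve of a good cover of a contractible space by translates, with finitely many
`Γ`-orbits of simplices and free `Γ`-action on the index set, is an exact coresolution of `M` by
finite sums of coinduced modules with finite cohomology) gives `finite_groupCohomology_gl2`.

## References

* A. Borel, J.-P. Serre, *Corners and arithmetic groups*, Comment. Math. Helv. 48 (1973), §11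
  [BorelSerre1973].
* J. Elstrodt, F. Grunewald, J. Mennicke, *Groups Acting on Hyperbolic Space* (1998), Ch. 2, Ch. 7
  [ElstrodtGrunewaldMennicke1998].
* K. S. Brown, *Cohomology of Groups* (1982), VII.4, VIII.2 [Brown1982CohomologyGroups].
-/

noncomputable section

open Matrix Complex NumberField CategoryTheory
open scoped MatrixGroups ComplexConjugate Pointwise

namespace Literature.NumberTheory.Automorphic

namespace BianchiCusp

open BianchiCone Literature.NumberTheory.NumberFields Literature.Algebra.Homology
open Literature.AlgebraicTopology.SingularHomology

section Cover

variable {K : Type*} [Field K] [NumberField K] (σ : K →+* ℂ)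

/-! ### Thick boxes around the points of the cone -/

/-- **Finitely many thick boxes suffice for the thick part**: there are a radius function `ε` on
the cone (the good radius of `exists_thickBox` at each point: compact hull inside the cone) and a
finite set `t` of points of the cone such that every form at which all cusps have depth `≥ 1` is
moved by some `γ ∈ GL₂(𝓞_K)` into the cone over the thick box of a member of `t`.
[cite: ElstrodtGrunewaldMennicke1998, Ch. 7 §7.3] -/
theorem exists_thick_finset [IsTotallyComplex K] (hK : Module.finrank ℚ K = 2) :
    ∃ (t : Finset ↥cone) (ε : ↥cone → ℝ),
      (∀ j : ↥cone, IsCompact (hermForm '' Metric.closedBall (coords (j : Mat)) (ε j)) ∧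
        hermForm '' Metric.closedBall (coords (j : Mat)) (ε j) ⊆ cone ∧
        cone ∩ thickBox (coords (j : Mat)) (ε j) ⊆ hermForm '' Metric.closedBall (coords (j : Mat)) (ε j)) ∧
      ∀ H ∈ cone, (∀ v : OVec K, v ≠ 0 → 1 ≤ depth σ v H) →
        ∃ γ : GL (Fin 2) (𝓞 K), ∃ j ∈ t, act (toGL σ γ) H ∈ coneOver (thickBox (coords (j : Mat)) (ε j)) := by
  classical
  choose ε hε using fun j : ↥cone => exists_thickBox j.2
  obtain ⟨F, hFc, hFcone, hF⟩ := exists_compact_fundamental σ hK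
  obtain ⟨t, ht⟩ := hFc.elim_finite_subcover (fun j : ↥cone => thickBox (coords (j : Mat)) (ε j))
    (fun j => isOpen_thickBox _ _)
    (fun H hH => Set.mem_iUnion.2 ⟨⟨H, hFcone hH⟩, (hε ⟨H, hFcone hH⟩).2.1⟩)
  refine ⟨t, ε, fun j => ⟨(hε j).2.2.1, (hε j).2.2.2.1, (hε j).2.2.2.2⟩, ?_⟩
  intro H hH hthick
  obtain ⟨γ, s, hs, hsF⟩ := hF H hH hthick
  obtain ⟨i, hi, hmem⟩ := Set.mem_iUnion₂.1 (ht hsF)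
  exact ⟨γ, i, hi, s, hs, hmem⟩

/-! ### Forms with a shallow cusp -/

omit [NumberField K] in
/-- `γ u ≠ 0` for `u ≠ 0`. [folklore] -/
theorem mulVec_ne_zero (γ : GL (Fin 2) (𝓞 K)) {u : OVec K} (hu : u ≠ 0) :
    (γ : Matrix (Fin 2) (Fin 2) (𝓞 K)) *ᵥ u ≠ 0 := by
  intro h0
  apply hu
  rw [← idealOf_eq_bot_iff, ← idealOf_mulVec γ u, h0, idealOf_eq_bot_iff]

/-- **A form with a cusp of depth `< 1` is moved into the cusp box of a representative**: if the
finite set `T` represents all cusp classes and `δ > (1 + |σω|)/2` for some `ω ∈ 𝓞_K ∖ ℝ`, then for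
`H ∈ 𝒫` with `depth_v H < 1` there are `γ ∈ GL₂(𝓞_K)` and `u ∈ T` with `γ • H` in the cusp box
`{depth_u < 1, |w_u| < δ}`. [cite: ElstrodtGrunewaldMennicke1998, Ch. 7 §7.3] -/
theorem exists_act_mem_cuspBox [IsTotallyComplex K] (hK : Module.finrank ℚ K = 2) {T : Finset (OVec K)}
    (hT0 : ∀ u ∈ T, u ≠ 0) (hT : ∀ v : OVec K, v ≠ 0 → ∃ u ∈ T, CuspRel v u)
    {ω : 𝓞 K} (hω : (σ ω).im ≠ 0) {δ : ℝ} (hδ : (1 + ‖σ (ω : K)‖) / 2 < δ)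
    {H : Mat} (hH : H ∈ cone) {v : OVec K} (hv : v ≠ 0) (hd : depth σ v H < 1) :
    ∃ (γ : GL (Fin 2) (𝓞 K)) (u : OVec K) (hu : u ∈ T), act (toGL σ γ) H ∈ cuspBox σ (hT0 u hu) δ := by
  obtain ⟨u, huT, γ, x', y', hx', hy', hrel⟩ := hT v hv
  have hu := hT0 u huT
  -- `depth_u (γ⁻¹ • H) = depth_v H < 1`
  have h1 : depth σ ((γ : Matrix (Fin 2) (Fin 2) (𝓞 K)) *ᵥ u) H = depth σ v H := by
    rw [← depth_cmul σ hK hy' ((γ : Matrix (Fin 2) (Fin 2) (𝓞 K)) *ᵥ u) H, ← hrel, depth_cmul σ hK hx']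
  set H' : Mat := act (toGL σ γ⁻¹) H with hH'
  have hH'c : H' ∈ cone := act_mem_cone _ hH
  have hd' : depth σ u H' < 1 := by
    rw [hH', map_inv, depth_act_inv σ hK γ u hH.1, h1]; exact hd
  -- translate the horizontal coordinate into the box
  obtain ⟨x₀, hx₀⟩ := ImaginaryQuadratic.exists_norm_sub_le σ hω (hcoord σ hu H')
  refine ⟨transl u x₀ * γ⁻¹, u, huT, ?_⟩
  rw [map_mul, act_mul, ← hH']
  refine ⟨act_mem_cone _ hH'c, ?_, ?_⟩
  · rw [depth_act_transl σ hK x₀ hH'c.1]; exact hd'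
  · rw [hcoord_act_transl σ hu x₀ hH'c]; exact hx₀.trans_lt hδ

/-- **Two cusp boxes met by `γ`-related points belong to equivalent cusps**: if
`γ⁻¹ • H ∈ box_u` and `H ∈ box_{u'}` then `u ∼ u'`. [cite: ElstrodtGrunewaldMennicke1998, Ch. 7 §7.3] -/
theorem cuspRel_of_mem_cuspBox [IsTotallyComplex K] (hK : Module.finrank ℚ K = 2) {u u' : OVec K}
    (hu : u ≠ 0) (hu' : u' ≠ 0) {δ : ℝ} {γ : GL (Fin 2) (𝓞 K)} {H : Mat}
    (h : act (toGL σ γ⁻¹) H ∈ cuspBox σ hu δ) (h' : H ∈ cuspBox σ hu' δ) : CuspRel u u' := by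
  obtain ⟨hH, hd', -⟩ := h'
  obtain ⟨-, hd, -⟩ := h
  rw [map_inv, depth_act_inv σ hK γ u hH.1] at hd
  have hpar := det2_eq_zero_of_depth_lt_one σ hK hH hd hd'
  have h1 : CuspRel ((γ : Matrix (Fin 2) (Fin 2) (𝓞 K)) *ᵥ u) u' :=
    cuspRel_of_det2_eq_zero (mulVec_ne_zero γ hu) hu' hpar
  have h2 : CuspRel ((γ : Matrix (Fin 2) (Fin 2) (𝓞 K)) *ᵥ u) u :=
    ⟨γ, 1, 1, one_ne_zero, one_ne_zero, rfl⟩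
  exact h2.symm.trans h1

/-! ### Local finiteness -/

/-- **Thick–thick**: only finitely many `γ` move a point of the cone over one thick box into the
cone over another, when the traces of the boxes on the cone lie in compact subsets `C, C'` of the
cone. [cite: ElstrodtGrunewaldMennicke1998, Ch. 2 §2.2] -/
theorem finite_thick_thick [IsTotallyComplex K] (hK : Module.finrank ℚ K = 2) {q q' : ℝ × ℝ × ℂ}
    {ε ε' : ℝ} {C C' : Set Mat} (hC : IsCompact C) (hCc : C ⊆ cone) (hsub : cone ∩ thickBox q ε ⊆ C)
    (hC' : IsCompact C') (hC'c : C' ⊆ cone) (hsub' : cone ∩ thickBox q' ε' ⊆ C') :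
    {γ : GL (Fin 2) (𝓞 K) | ∃ H ∈ cone,
      act (toGL σ γ⁻¹) H ∈ coneOver (thickBox q ε) ∧ H ∈ coneOver (thickBox q' ε')}.Finite := by
  refine ((finite_gamma_meeting σ hK hC' hC hC'c hCc).preimage inv_injective.injOn).subset ?_
  rintro γ ⟨H, hH, ⟨s, hs, hsH⟩, ⟨s', hs', hs'H⟩⟩
  refine ⟨s' • H, hsub' ⟨smul_mem_cone hs' hH, hs'H⟩, s / s', div_pos hs hs', ?_⟩
  rw [act_smul, smul_smul, div_mul_cancel₀ _ hs'.ne']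
  exact hsub ⟨smul_mem_cone hs (act_mem_cone _ hH), hsH⟩

/-- **Cusp–cusp (same cusp)**: only finitely many `γ` move a point of a cusp box into the same
cusp box. [cite: ElstrodtGrunewaldMennicke1998, Ch. 7 §7.3] -/
theorem finite_cusp_cusp [IsTotallyComplex K] (hK : Module.finrank ℚ K = 2) {u : OVec K} (hu : u ≠ 0)
    (δ : ℝ) :
    {γ : GL (Fin 2) (𝓞 K) | ∃ H ∈ cone, act (toGL σ γ⁻¹) H ∈ cuspBox σ hu δ ∧ H ∈ cuspBox σ hu δ}.Finite := by
  refine (finite_parabolic_of_hcoord_le σ hu hK δ).subset ?_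
  rintro γ ⟨H, hH, ⟨hH', hd, hw⟩, ⟨-, hd', hw'⟩⟩
  refine ⟨?_, act (toGL σ γ⁻¹) H, hH', hw.le, ?_⟩
  · rw [map_inv, depth_act_inv σ hK γ u hH.1] at hd
    exact det2_eq_zero_of_depth_lt_one σ hK hH hd hd'
  · rw [map_inv, ← act_mul, mul_inv_cancel, act_one]; exact hw'.le

/-- **Thick–cusp**: only finitely many `γ` move a point of the cone over a thick box (with trace in
a compact `C ⊆ 𝒫`) into a cusp box. [cite: ElstrodtGrunewaldMennicke1998, Ch. 7 §7.3] -/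
theorem finite_thick_cusp [IsTotallyComplex K] (hK : Module.finrank ℚ K = 2) {q : ℝ × ℝ × ℂ} {ε : ℝ}
    {C : Set Mat} (hC : IsCompact C) (hCc : C ⊆ cone) (hsub : cone ∩ thickBox q ε ⊆ C)
    {u : OVec K} (hu : u ≠ 0) (δ : ℝ) :
    {γ : GL (Fin 2) (𝓞 K) | ∃ H ∈ cone,
      act (toGL σ γ⁻¹) H ∈ coneOver (thickBox q ε) ∧ H ∈ cuspBox σ hu δ}.Finite := by
  refine (finite_gamma_cusp σ hK hu hC hCc δ).subset ?_
  rintro γ ⟨H, hH, ⟨s, hs, hsH⟩, ⟨-, hd, hw⟩⟩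
  refine ⟨s • act (toGL σ γ⁻¹) H, hsub ⟨smul_mem_cone hs (act_mem_cone _ hH), hsH⟩, ?_, ?_⟩
  · rw [act_smul, map_inv, ← act_mul, mul_inv_cancel, act_one, depth_smul_mat σ hs]; exact hd
  · rw [act_smul, map_inv, ← act_mul, mul_inv_cancel, act_one, hcoord_smul σ hu hs.ne']; exact hw.le

/-- **Cusp–thick**: only finitely many `γ` move a point of a cusp box into the cone over a thick
box (with trace in a compact `C ⊆ 𝒫`). [cite: ElstrodtGrunewaldMennicke1998, Ch. 7 §7.3] -/
theorem finite_cusp_thick [IsTotallyComplex K] (hK : Module.finrank ℚ K = 2) {u : OVec K} (hu : u ≠ 0)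
    (δ : ℝ) {q : ℝ × ℝ × ℂ} {ε : ℝ} {C : Set Mat} (hC : IsCompact C) (hCc : C ⊆ cone)
    (hsub : cone ∩ thickBox q ε ⊆ C) :
    {γ : GL (Fin 2) (𝓞 K) | ∃ H ∈ cone,
      act (toGL σ γ⁻¹) H ∈ cuspBox σ hu δ ∧ H ∈ coneOver (thickBox q ε)}.Finite := by
  refine ((finite_gamma_cusp σ hK hu hC hCc δ).preimage inv_injective.injOn).subset ?_
  rintro γ ⟨H, hH, ⟨-, hd, hw⟩, ⟨s, hs, hsH⟩⟩
  refine ⟨s • H, hsub ⟨smul_mem_cone hs hH, hsH⟩, ?_, ?_⟩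
  · rw [act_smul, depth_smul_mat σ hs]; exact hd
  · rw [act_smul, hcoord_smul σ hu hs.ne']; exact hw.le

end Cover

/-! ### The finiteness theorem -/

section Finite

variable {K : Type} [Field K] [NumberField K]

/-- An imaginary quadratic field has a complex embedding. [folklore] -/
theorem nonempty_ringHom_complex (hK : Module.finrank ℚ K = 2) : Nonempty (K →+* ℂ) := by
  rw [← Fintype.card_pos_iff, NumberField.Embeddings.card K ℂ, hK]
  exact two_pos

/-- **Finiteness of `Hⁿ(GL₂(𝓞_K), M)` for finite `M`, `K` imaginary quadratic.**
[cite: BorelSerre1973, §11 Thm. 11.4.4] [cite: ElstrodtGrunewaldMennicke1998, Ch. 7 §7.3] -/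
theorem finite_groupCohomology_gl2 [IsTotallyComplex K] (hK : Module.finrank ℚ K = 2)
    (A : Rep ℤ (GL (Fin 2) (𝓞 K))) [Finite A] (n : ℕ) : Finite (groupCohomology A n) := by
  classical
  obtain ⟨σ⟩ := nonempty_ringHom_complex hK
  -- the action of `Γ` on the cone through `σ`
  letI : MulAction (GL (Fin 2) (𝓞 K)) ↥cone := MulAction.compHom ↥cone (toGL σ)
  haveI : ContinuousConstSMul (GL (Fin 2) (𝓞 K)) ↥cone := ⟨fun γ => continuous_const_smul (toGL σ γ)⟩
  have coe_gsmul : ∀ (γ : GL (Fin 2) (𝓞 K)) (x : ↥cone), ((γ • x : ↥cone) : Mat) = act (toGL σ γ) x :=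
    fun _ _ => rfl
  -- the data
  obtain ⟨t, ε, hε, hthick⟩ := exists_thick_finset σ hK
  obtain ⟨T, hT0, hT1, hT⟩ := exists_inequivalent_representatives (K := K)
  obtain ⟨ω, hω⟩ := ImaginaryQuadratic.exists_im_ne_zero (K := K) σ
  set δ : ℝ := (1 + ‖σ (ω : K)‖) / 2 + 1 with hδ
  have hδ' : (1 + ‖σ (ω : K)‖) / 2 < δ := by rw [hδ]; linarith
  -- prototypes (as subsets of `M₂(ℂ)` contained in the cone) and the cover pieces
  let P : ↥t ⊕ ↥T → Set Mat := Sum.elim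
    (fun j => cone ∩ coneOver (thickBox (coords (j.1 : Mat)) (ε j.1)))
    (fun u => cuspBox σ (hT0 u.1 u.2) δ)
  let V : ↥t ⊕ ↥T → Set ↥cone := fun b => {x | (x : Mat) ∈ P b}
  have hPcone : ∀ b, P b ⊆ cone := by
    rintro (j | u)
    · exact Set.inter_subset_left
    · exact fun H hH => hH.1
  have hPconv : ∀ b, Convex ℝ (P b) := by
    rintro (j | u)
    · exact convex_cone.inter (convex_coneOver (convex_thickBox _ _))
    · exact convex_cuspBox σ _ δ
  have hV : ∀ b, IsOpen (V b) := by
    rintro (j | u)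
    · have : V (Sum.inl j) = {x : ↥cone | (x : Mat) ∈ coneOver (thickBox (coords (j.1 : Mat)) (ε j.1))} := by
        ext x
        exact ⟨fun h => h.2, fun h => ⟨x.2, h⟩⟩
      rw [this]
      exact isOpen_coe_preimage_coneOver (isOpen_thickBox _ _)
    · exact isOpen_coe_preimage_cuspBox σ _ δ
  have hsmul : ∀ (γ : GL (Fin 2) (𝓞 K)) (b : ↥t ⊕ ↥T) (x : ↥cone),
      x ∈ γ • V b ↔ act (toGL σ γ⁻¹) (x : Mat) ∈ P b := by
    intro γ b x
    rw [Set.mem_smul_set_iff_inv_smul_mem]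
    rfl
  have hsmul' : ∀ (γ : GL (Fin 2) (𝓞 K)) (b : ↥t ⊕ ↥T),
      γ • V b = {x : ↥cone | (x : Mat) ∈ act (toGL σ γ) '' P b} := by
    intro γ b
    ext x
    rw [hsmul]
    constructor
    · intro h
      exact ⟨_, h, by rw [map_inv, ← act_mul, mul_inv_cancel, act_one]⟩
    · rintro ⟨M, hM, hMx⟩
      rw [← hMx, map_inv, ← act_mul, inv_mul_cancel, act_one]
      exact hM
  refine finite_groupCohomology_of_translateCover (S := GL (Fin 2) (𝓞 K)) V hV ?_ ?_ ?_ A n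
  · -- the translates cover
    intro x
    by_cases h : ∃ v : OVec K, v ≠ 0 ∧ depth σ v (x : Mat) < 1
    · obtain ⟨v, hv, hd⟩ := h
      obtain ⟨γ, u, huT, hmem⟩ := exists_act_mem_cuspBox σ hK hT0 hT hω hδ' x.2 hv hd
      refine ⟨γ⁻¹, Sum.inr ⟨u, huT⟩, (hsmul _ _ _).2 ?_⟩
      rw [inv_inv]
      exact hmem
    · push Not at h
      obtain ⟨γ, j, hj, hmem⟩ := hthick x x.2 h
      refine ⟨γ⁻¹, Sum.inl ⟨j, hj⟩, (hsmul _ _ _).2 ?_⟩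
      rw [inv_inv]
      exact ⟨act_mem_cone _ x.2, hmem⟩
  · -- finite intersections of translates are contractible
    intro p J hne
    have hEq : cechSet (translCover (S := GL (Fin 2) (𝓞 K)) V) J =
        {x : ↥cone | (x : Mat) ∈ ⋂ k, act (toGL σ (J k).g) '' P (J k).b} := by
      ext x
      simp only [mem_cechSet_iff, translCover_apply, hsmul', Set.mem_setOf_eq, Set.mem_iInter]
    rw [hEq] at hne ⊢
    obtain ⟨x, hx⟩ := hne
    refine contractibleSpace_coe_preimage (convex_iInter fun k => convex_image_act _ (hPconv _)) ?_ ⟨_, hx⟩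
    intro M hM
    obtain ⟨N, hN, rfl⟩ := Set.mem_iInter.1 hM 0
    exact act_mem_cone _ (hPcone _ hN)
  · -- local finiteness
    intro b b'
    have hsub : {γ : GL (Fin 2) (𝓞 K) | (γ • V b ∩ V b').Nonempty} ⊆
        {γ | ∃ H ∈ cone, act (toGL σ γ⁻¹) H ∈ P b ∧ H ∈ P b'} := by
      rintro γ ⟨x, hx, hx'⟩
      exact ⟨x, x.2, (hsmul γ b x).1 hx, hx'⟩
    refine Set.Finite.subset ?_ hsub
    rcases b with j | u <;> rcases b' with j' | u'
    · refine (finite_thick_thick σ hK (hε j.1).1 (hε j.1).2.1 (hε j.1).2.2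
        (hε j'.1).1 (hε j'.1).2.1 (hε j'.1).2.2).subset ?_
      rintro γ ⟨H, hH, ⟨-, h1⟩, ⟨-, h2⟩⟩
      exact ⟨H, hH, h1, h2⟩
    · refine (finite_thick_cusp σ hK (hε j.1).1 (hε j.1).2.1 (hε j.1).2.2 (hT0 u'.1 u'.2) δ).subset ?_
      rintro γ ⟨H, hH, ⟨-, h1⟩, h2⟩
      exact ⟨H, hH, h1, h2⟩
    · refine (finite_cusp_thick σ hK (hT0 u.1 u.2) δ (hε j'.1).1 (hε j'.1).2.1 (hε j'.1).2.2).subset ?_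
      rintro γ ⟨H, hH, h1, ⟨-, h2⟩⟩
      exact ⟨H, hH, h1, h2⟩
    · by_cases huu : (u : OVec K) = u'
      · obtain rfl : u = u' := Subtype.ext huu
        exact finite_cusp_cusp σ hK (hT0 u.1 u.2) δ
      · convert Set.finite_empty
        ext γ
        simp only [Set.mem_setOf_eq, Set.mem_empty_iff_false, iff_false]
        rintro ⟨H, -, h1, h2⟩
        exact huu (hT1 _ u.2 _ u'.2 (cuspRel_of_mem_cuspBox σ hK (hT0 u.1 u.2) (hT0 u'.1 u'.2) h1 h2))

/-- **Finiteness of `H^q(Γ_U, M)` for congruence subgroups of `GL₂` over an imaginary quadratic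
field**: for `U ≤ GL₂(𝔸_K^∞)` compact open, `Γ_U = GL₂(K) ∩ U` and `M` a finite `ℤ[Γ_U]`-module,
`H^q(Γ_U, M)` is finite.  From `finite_groupCohomology_gl2` by transport to the image of
`GL₂(𝓞_K)` in `GL₂(K)` and commensurability of `Γ_U` with it.
[cite: BorelSerre1973, §11 Thm. 11.4.4, 11.6] [cite: Serre1971CohomologieGroupesDiscrets, §2.4 Th. 4 (a)] -/
theorem finite_groupCohomology_congruenceSubgroup_gl2 [IsTotallyComplex K] (hK : Module.finrank ℚ K = 2)
    (U : Subgroup (BigHeckeGLn.FiniteAdelicGL 2 K)) (hUo : IsOpen (U : Set (BigHeckeGLn.FiniteAdelicGL 2 K)))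
    (hUc : IsCompact (U : Set (BigHeckeGLn.FiniteAdelicGL 2 K)))
    (A : Rep ℤ (U.comap (BigHeckeGLn.globalEmbedding 2 K))) [Finite A] (q : ℕ) :
    Finite (groupCohomology A q) := by
  have h₀ : ∀ (B : Rep ℤ (GL (Fin 2) (𝓞 K))), Finite B → ∀ m, Finite (groupCohomology B m) :=
    fun B hB m => by
      haveI := hB
      exact finite_groupCohomology_gl2 hK B m
  -- transport to the image of `GL₂(𝓞_K)` in `GL₂(K)`
  have h₁ : ∀ (B : Rep ℤ (Matrix.GeneralLinearGroup.map (algebraMap (𝓞 K) K) :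
      GL (Fin 2) (𝓞 K) →* GL (Fin 2) K).range), Finite B → ∀ m, Finite (groupCohomology B m) :=
    fun B hB m => by
      haveI := hB
      exact finite_groupCohomology_of_mulEquiv
        (MonoidHom.ofInjective (BigHeckeGLn.map_algebraMap_ringOfIntegers_injective 2 K)) h₀ B m
  -- `Γ_U` is commensurable with it
  have hc := BigHeckeGLn.commensurable_comap_globalEmbedding_glIntegers U hUo hUc
  haveI : ((U.comap (BigHeckeGLn.globalEmbedding 2 K)).subgroupOf (Matrix.GeneralLinearGroup.map
      (algebraMap (𝓞 K) K) : GL (Fin 2) (𝓞 K) →* GL (Fin 2) K).range).FiniteIndex := ⟨hc.1⟩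
  haveI : ((Matrix.GeneralLinearGroup.map (algebraMap (𝓞 K) K) :
      GL (Fin 2) (𝓞 K) →* GL (Fin 2) K).range.subgroupOf
        (U.comap (BigHeckeGLn.globalEmbedding 2 K))).FiniteIndex := ⟨hc.2⟩
  exact finite_groupCohomology_of_commensurable _ _ h₁ A q

end Finite

end BianchiCusp

end Literature.NumberTheory.Automorphic
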